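import Summits.QuantumFields.YangMills.Theorems.BalabanUVNodesN15KingModelFineFieldGeneratingFunctional
import Summits.QuantumFields.YangMills.Theorems.BalabanUVNodesN15KingModelBlockFieldMeasureContinuumLimit
import Literature.MathematicalPhysics.QuantumFieldTheory.King1986.ContinuumLimitStatements

/-!
# BalabanUVNodes ∕ N15 — THE KING-MODEL RUNG (PART Ϝ-b): KING's THEOREM 2.1 (2.22)–(2.23) BY NAME — `Thm21Printed` INHABITED — FOR THE FREE FIELD
# WITH BLOCK-CONSTANT SOURCES ON EVERY TORUS (2.21): `Z^{ε_K}(T_{ε_K}, h) → Z(T, h) = exp(½|Ω_T|⁻¹Σ_q S_∞(p′(q))|J̃(q)|²)`, `|ln Z(T, h)| ≤ H²|T|∕(2m²)`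
# (Track A, DAG node N15 = NE2; FAN-OUT v1.1 §N15 s3 «KING-MODEL RUNG … NE2's analogue DECIDED in the model»)

HONEST FRAMING.  Count-neutral (cell `pub-ymgap`, seat `pub-ymgap-dag-n15-e` g33; `--supports stmt-QuantumFields-27366 --as helper` = K3⁸
`SpineGivenEndpointR13SepCoPHV`).  TEMPLATE LITERATURE: C. King, *The U(1) Higgs model. I. The continuum limit*, Commun. Math. Phys. **102** (1986) 649–677
[King1986] — KING's OWN `A = 0`, `g = 0` MODEL: the FREE massive lattice scalar field on the lattices `T_{ε_K}` of a torus (2.21), `ε_K = L^{−K}`.  The typer's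
schema `King1986.ContinuumLimit.Thm21Printed Z` (`∃ C, ∀ T : Torus221, ∃ Z(T) > 0, Z^{ε_K}(T) → Z(T) ∧ |ln Z(T)| ≤ C|T|`, file `King1986/ContinuumLimitStatements`) is the
PRINTED Theorem 2.1 over abstract generating functionals; it is INHABITED here by the free model's functional at block-constant sources — NOT by the interacting U(1)
Higgs model's `Z^ε(T_ε, g, h)` (whose construction is [Ba 1–4] + King §3, not in the tree).  NOT Bałaban's objects; NOT a node discharge (N15 is booked through n15-a's
knit, untouched here); nothing continuum-Yang–Mills ∕ ℝ⁴ ∕ OS ∕ mass-gap ∕ Clay.  0 `sorry`; standard axioms; FOUR definitions (`t221Sites`, `kingFreeZ`, `kingFreeZlim`,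
`kingBlockZ` — plumbing ∕ the objects themselves).

THE MATHEMATICS.  A torus (2.21) `T : Torus221 (d+1)` (large-block integer `M`, half-sides `L_μ` with `2L_μ = n_μM`) has, at every level `K`, the SAME unit lattice
`Ω_T = Π_μ ℤ∕(n_μM)` after `K` block-spin steps (`|Ω_T| = Π_μ 2L_μ = |T|`), and the fine lattice `T_{ε_K} = Tor (fine (L^K) Ω_T)` with `ε_K^{d+1}|T_{ε_K}| = |T|` (King's
*"T can be fitted exactly"*).  For a source family `J_T : Ω_T → ℝ` with `|J_T| ≤ H`, part Ϝ-a gives `Z^{ε_K}(T_{ε_K}, J_T∘blk) = exp(½|Ω_T|⁻¹Σ_q S_{L^K}(q)|J̃_T(q)|²)`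
EXACTLY, with `0 ≤ ln Z^{ε_K} ≤ H²|T|∕(2m²)` for every `K`; part Ϡ-c (`tendsto_Sfib_pow`: `S_{L^K}(q) → S_∞(p′(q))`, Tannery over King's digits, odd `L`) passes the finite sum
to the limit: (2.22) `Z^{ε_K}(T_{ε_K}, J_T∘blk) → Z(T, J_T) := exp(½|Ω_T|⁻¹Σ_q S_∞(p′(q))|J̃_T(q)|²) > 0`, and the closed bounds pass too: (2.23) `|ln Z(T, J_T)| ≤ (H²∕(2m²))·|T|`
with ONE constant for all tori — `Thm21Printed (kingFreeZ L m² J)`.  The RG-side reading (sources coupled to the unit-lattice block field `ψ_K` of Theorem 3.1's effective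
actions, law `ρ_K = e^{−½⟨ψ,Δ^{(K)}ψ⟩}∕𝒩(Δ^{(K)})`): `Z′(T, K) := ∫e^{⟨J_T,ψ⟩}ρ_K = exp(½⟨J_T,(Δ^{(K)})⁻¹J_T⟩) → exp(½⟨J_T, C^{(∞)}J_T⟩)` (part Ϡ-k) with `0 ≤ ln ≤ ½(a_∞⁻¹ +
m⁻²)H²|T|` — `Thm21Printed (kingBlockZ L a m² J)`; and the two are ONE functional up to the block-spin white noise ((2.15), part Ϛ's Woodbury form):
`Z′(T, K) = Z^{ε_K}(T_{ε_K}, J_T∘blk)·e^{|J_T|²∕(2a_K)}`.  By-product: the SHARP ceiling `S_∞(p′(q)) ≤ m⁻²` (limit of Ϝ-a's `Sfib_le_inv_mass`), improving 252's majorant.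

WHAT THIS FILE PROVES (kernel).  §0 ★ `aliasSeries0_sOf_le_inv_mass` (`S_∞(p′(q)) ≤ m⁻²`), `fourierSum_aliasSeries0_le` ∕ `_nonneg`, ★ `blockCovLim_form_le_sharp` (`⟨φ,C^{(∞)}φ⟩ ≤
(a_∞⁻¹ + m⁻²)|φ|²`).  §1 `t221Sites` (`n_μM`), `t221Sites_cast` (`= 2L_μ`), `t221Sites_pos`, `t221Sites_neZero`, ★ `card_tor_t221Sites` (`|Ω_T| = |T|`), ★ `eps_pow_mul_card_fine`
(`ε_K^{d+1}|T_{ε_K}| = |T|`).  §2 `kingFreeZ`, `kingFreeZlim`, `kingFreeZ_eq`, ★★ **`tendsto_kingFreeZ`** ((2.22)), `kingFreeZlim_pos`, `log_kingFreeZlim_eq`, `log_kingFreeZlim_nonneg`,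
★★ **`abs_log_kingFreeZlim_le`** ((2.23), `C = H²∕(2m²)`), `abs_log_kingFreeZ_le` (the same at every `K`), ★★★ **`thm21Printed_kingFreeZ`** (FIRST INHABITANT of `Thm21Printed`).
§3 `kingBlockZ`, `kingBlockZ_eq_exp` (`K ≥ 1`), ★★ `kingBlockZ_eq_kingFreeZ_mul` ((2.15) bridge), ★★ `tendsto_kingBlockZ`, `abs_log_kingBlockZlim_le`, ★★★ **`thm21Printed_kingBlockZ`**.

HONEST SCOPE.  Free field only (`g = 0`, `A = 0`); sources constant on unit blocks (a fine source that is not block-constant is covered by Ϝ-a's uniform bound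
`ln Z ≤ ‖h‖²_η∕(2m²)` but its `K → ∞` limit is not addressed here); odd `L ≥ 3` de facto (`Odd L ∧ 2 ≤ L`), `m² > 0`, `a > 0`; every torus (2.21) in dimension `d + 1 ≥ 1`.
Theorem 2.1 for the U(1) Higgs model is NOT claimed.  N15 untouched; counts unmoved.
Locators: [King1986] (2.1)–(2.6) pp.651–652, (2.13)–(2.16) p.653, (2.21)–(2.23) p.654, (3.9) p.656, (4.5) p.670, (4.35) p.674.
-/

noncomputable section

open scoped BigOperators
open Finset Matrix Filter Topology MeasureTheory

namespace Summit.QuantumFields.YangMills.BalabanUVNodes.N15KingModelRung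

open Literature.MathematicalPhysics.QuantumFieldTheory.Balaban1983to89.B5Prop11Plancherel (Tor fine chi sOf)
open Literature.MathematicalPhysics.QuantumFieldTheory.Balaban1983to89.QGQInverse (Coercive)
open Literature.MathematicalPhysics.QuantumFieldTheory.King1986 (aK aK_pos)
open Literature.MathematicalPhysics.QuantumFieldTheory.King1986.Torus
open Literature.MathematicalPhysics.QuantumFieldTheory.King1986.ContinuumLimit (eps eps_pos Torus221 Thm21Printed)
open Summit.QuantumFields.YangMills.BalabanUVNodes.N15KingModelRung.FreeField (gaussNorm gaussNorm_pos integral_exp_dot_gaussDensity)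

variable {d : ℕ}

/-! ## §0 The sharp ceiling of the continuum alias series on torus momenta -/

section Sharp

variable (L : ℕ) (M : Fin (d + 1) → ℕ) [hM : ∀ μ, NeZero (M μ)]

/-- ★ **`S_∞(p′(q)) ≤ m⁻²`** at every torus momentum (odd `L ≥ 2`, `m² > 0`): the limit of `S_{L^K}(q) ≤ m⁻²` (part Ϝ-a `Sfib_le_inv_mass`, part Ϡ-c `tendsto_Sfib_pow`).
[cite: King1986, (4.5) p.670, (4.14) p.671] -/
theorem aliasSeries0_sOf_le_inv_mass (hLodd : Odd L) (hL : 2 ≤ L) {m2 : ℝ} (hm : 0 < m2) (q : Tor M) :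
    aliasSeries0 m2 (sOf M q) ≤ m2⁻¹ := by
  haveI : NeZero L := ⟨by omega⟩
  exact le_of_tendsto (tendsto_Sfib_pow L M hLodd hL hm q)
    (Filter.Eventually.of_forall fun K => Sfib_le_inv_mass (L ^ K) M (by positivity) hm q)

/-- `0 ≤ |Ω|⁻¹Σ_q S_∞(p′(q))|J̃(q)|²`. [folklore] -/
theorem fourierSum_aliasSeries0_nonneg {m2 : ℝ} (hm : 0 < m2) (J : Tor M → ℝ) :
    0 ≤ (Fintype.card (Tor M) : ℝ)⁻¹ * ∑ q : Tor M, aliasSeries0 m2 (sOf M q) * ‖ft M J q‖ ^ 2 :=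
  mul_nonneg (by positivity) (Finset.sum_nonneg fun q _ => mul_nonneg (aliasSeries0_nonneg hm.le _) (sq_nonneg _))

/-- `|Ω|⁻¹Σ_q S_∞(p′(q))|J̃(q)|² ≤ m⁻²⟨J, J⟩` (sharp ceiling + Plancherel). [cite: King1986, (4.5) p.670, (4.35) p.674] -/
theorem fourierSum_aliasSeries0_le (hLodd : Odd L) (hL : 2 ≤ L) {m2 : ℝ} (hm : 0 < m2) (J : Tor M → ℝ) :
    (Fintype.card (Tor M) : ℝ)⁻¹ * ∑ q : Tor M, aliasSeries0 m2 (sOf M q) * ‖ft M J q‖ ^ 2 ≤ m2⁻¹ * (J ⬝ᵥ J) := by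
  calc (Fintype.card (Tor M) : ℝ)⁻¹ * ∑ q : Tor M, aliasSeries0 m2 (sOf M q) * ‖ft M J q‖ ^ 2
      ≤ (Fintype.card (Tor M) : ℝ)⁻¹ * ∑ q : Tor M, m2⁻¹ * ‖ft M J q‖ ^ 2 := by
        gcongr with q _
        exact aliasSeries0_sOf_le_inv_mass L M hLodd hL hm q
    _ = m2⁻¹ * (J ⬝ᵥ J) := by
        have hcard : (0 : ℝ) < Fintype.card (Tor M) := by exact_mod_cast Fintype.card_pos
        rw [← Finset.mul_sum, ← parseval_dot]
        field_simp

/-- ★ **The sharp ceiling of the continuum block covariance**: `⟨φ, C^{(∞)}φ⟩ ≤ (a_∞⁻¹ + m⁻²)·⟨φ, φ⟩` (improves part Ϡ-f's `blockCovLim_form_le`).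
[cite: King1986, (2.14) p.653, (4.5) p.670, (4.8) p.671] -/
theorem blockCovLim_form_le_sharp (hLodd : Odd L) (hL : 2 ≤ L) {a m2 : ℝ} (ha : 0 < a) (hm : 0 < m2) (φ : Tor M → ℝ) :
    φ ⬝ᵥ ((Matrix.of fun b b' => blockCovLim L M a m2 b b') *ᵥ φ) ≤ ((aInf a L)⁻¹ + m2⁻¹) * (φ ⬝ᵥ φ) := by
  rw [blockCovLim_form L M hLodd hL ha hm φ, add_mul]
  exact add_le_add_right (fourierSum_aliasSeries0_le L M hLodd hL hm φ) _

end Sharp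

/-! ## §1 The torus (2.21) and its lattices: `|Ω_T| = |T|`, `ε_K^{d+1}|T_{ε_K}| = |T|` -/

section Torus

/-- The number of UNIT-lattice sites per direction of a torus (2.21): `2L_μ = n_μ·M` (`n_μ` from the fitting condition `2L_μM⁻¹ ∈ ℕ`); this is the side of the
unit lattice `T_1^{(K)}` after `K` block-spin steps, for every `K`. [cite: King1986, (2.21) p.654, (2.7) p.652] -/
def t221Sites (T : Torus221 (d + 1)) : Fin (d + 1) → ℕ := fun μ => Classical.choose (T.fit μ) * T.M

/-- `(n_μM : ℝ) = 2L_μ`. [cite: King1986, (2.21) p.654] -/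
theorem t221Sites_cast (T : Torus221 (d + 1)) (μ : Fin (d + 1)) : (t221Sites T μ : ℝ) = 2 * T.side μ := by
  have h := Classical.choose_spec (T.fit μ)
  unfold t221Sites
  push_cast
  exact h.symm

/-- `0 < n_μM`. [cite: King1986, (2.21) p.654] -/
theorem t221Sites_pos (T : Torus221 (d + 1)) (μ : Fin (d + 1)) : 0 < t221Sites T μ := by
  have h : (0 : ℝ) < t221Sites T μ := by rw [t221Sites_cast]; linarith [T.side_pos μ]
  exact_mod_cast h

/-- Each side is a nonzero natural (the instance the torus lemmas need). [folklore] -/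
theorem t221Sites_neZero (T : Torus221 (d + 1)) : ∀ μ, NeZero (t221Sites T μ) := fun μ => ⟨(t221Sites_pos T μ).ne'⟩

/-- ★ **`|Ω_T| = |T|`**: the unit lattice of the torus has `Π_μ 2L_μ = |T|` sites (King's `|T|` of (2.23)). [cite: King1986, (2.23) p.654] -/
theorem card_tor_t221Sites (T : Torus221 (d + 1)) :
    haveI := t221Sites_neZero T
    (Fintype.card (Tor (t221Sites T)) : ℝ) = T.vol := by
  haveI := t221Sites_neZero T
  rw [Fintype.card_pi]
  push_cast
  unfold Torus221.vol
  refine Finset.prod_congr rfl fun μ _ => ?_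
  rw [ZMod.card, t221Sites_cast]

/-- ★ **`ε_K^{d+1}·|T_{ε_K}| = |T|`**: the `ε_K`-lattice `T_{ε_K} = Tor (fine (L^K) Ω_T)` has `L^{K(d+1)}|T|` sites — *"T can be fitted exactly by … blocks"*, so the Riemann
sums `ε^dΣ_{x∈T_ε} 1` give the volume exactly. [cite: King1986, (2.21) p.654] -/
theorem eps_pow_mul_card_fine {L : ℕ} (hL : 0 < L) (T : Torus221 (d + 1)) (K : ℕ) :
    haveI := t221Sites_neZero T
    haveI : NeZero L := ⟨hL.ne'⟩
    eps L K ^ (d + 1) * (Fintype.card (Tor (fine (L ^ K) (t221Sites T))) : ℝ) = T.vol := by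
  haveI := t221Sites_neZero T
  haveI : NeZero L := ⟨hL.ne'⟩
  have hLK : ((L : ℝ) ^ K) ≠ 0 := pow_ne_zero _ (by exact_mod_cast hL.ne')
  rw [← card_tor_t221Sites T, Literature.MathematicalPhysics.QuantumFieldTheory.Balaban1983to89.B5Block118.card_fine, eps]
  push_cast
  rw [← mul_assoc, ← mul_pow, inv_mul_cancel₀ hLK, one_pow, one_mul]

end Torus

/-! ## §2 Theorem 2.1 for the free field at block-constant sources -/

section Free

variable (L : ℕ) [NeZero L] (m2 : ℝ)

/-- **The free model's generating functionals on the tori (2.21)**: `Z^{ε_K}(T_{ε_K}, J_T∘blk)` for a family of unit-block sources `J_T : Ω_T → ℝ` — King's fine-lattice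
Gaussian functional of part Ϝ-a on `T_{ε_K} = Tor (fine (L^K) Ω_T)`. [cite: King1986, (2.1) p.651, Thm 2.1 (2.22) p.654] -/
def kingFreeZ (J : ∀ T : Torus221 (d + 1), Tor (t221Sites T) → ℝ) : Torus221 (d + 1) → ℕ → ℝ := fun T K =>
  haveI := t221Sites_neZero T
  kingFineZ (L ^ K) (t221Sites T) m2 (blockSrc (L ^ K) (t221Sites T) (J T))

/-- **The limit functional** `Z(T, J_T) = exp(½|Ω_T|⁻¹Σ_q S_∞(p′(q))|J̃_T(q)|²)` — the continuum Gaussian generating functional at the block-constant source, in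
King's plane waves. [cite: King1986, Thm 2.1 (2.22) p.654, (4.5) p.670] -/
def kingFreeZlim (J : ∀ T : Torus221 (d + 1), Tor (t221Sites T) → ℝ) (T : Torus221 (d + 1)) : ℝ :=
  haveI := t221Sites_neZero T
  Real.exp ((1 / 2 : ℝ) * ((Fintype.card (Tor (t221Sites T)) : ℝ)⁻¹
    * ∑ q : Tor (t221Sites T), aliasSeries0 m2 (sOf (t221Sites T) q) * ‖ft (t221Sites T) (J T) q‖ ^ 2))

/-- `Z^{ε_K}(T_{ε_K}, J_T∘blk) = exp(½|Ω_T|⁻¹Σ_q S_{L^K}(q)|J̃_T(q)|²)` (part Ϝ-a on the torus). [cite: King1986, Thm 2.1 (2.22) p.654, (4.5) p.670] -/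
theorem kingFreeZ_eq (hm : 0 < m2) (J : ∀ T : Torus221 (d + 1), Tor (t221Sites T) → ℝ) (T : Torus221 (d + 1)) (K : ℕ) :
    haveI := t221Sites_neZero T
    kingFreeZ L m2 J T K = Real.exp ((1 / 2 : ℝ) * ((Fintype.card (Tor (t221Sites T)) : ℝ)⁻¹
      * ∑ q : Tor (t221Sites T), Sfib (L ^ K) (t221Sites T) (((L ^ K : ℕ) : ℝ) ^ 2) m2 q * ‖ft (t221Sites T) (J T) q‖ ^ 2)) := by
  haveI := t221Sites_neZero T
  unfold kingFreeZ
  rw [kingFineZ_blockSrc_eq_fourier (L ^ K) (t221Sites T) hm]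

/-- ★★ **THEOREM 2.1 (i) (2.22) FOR THE FREE FIELD**: on every torus (2.21), `Z^{ε_K}(T_{ε_K}, J_T∘blk) → Z(T, J_T)` as `K → ∞` (odd `L ≥ 2`, `m² > 0`).
[cite: King1986, Thm 2.1 (2.22) p.654] -/
theorem tendsto_kingFreeZ (hLodd : Odd L) (hL : 2 ≤ L) (hm : 0 < m2) (J : ∀ T : Torus221 (d + 1), Tor (t221Sites T) → ℝ) (T : Torus221 (d + 1)) :
    Tendsto (fun K : ℕ => kingFreeZ L m2 J T K) atTop (𝓝 (kingFreeZlim m2 J T)) := by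
  haveI := t221Sites_neZero T
  have hfun : (fun K : ℕ => kingFreeZ L m2 J T K) = fun K : ℕ => Real.exp ((1 / 2 : ℝ) * ((Fintype.card (Tor (t221Sites T)) : ℝ)⁻¹
      * ∑ q : Tor (t221Sites T), Sfib (L ^ K) (t221Sites T) (((L ^ K : ℕ) : ℝ) ^ 2) m2 q * ‖ft (t221Sites T) (J T) q‖ ^ 2)) :=
    funext fun K => kingFreeZ_eq L m2 hm J T K
  rw [hfun]
  unfold kingFreeZlim
  refine (Real.continuous_exp.tendsto _).comp ?_
  refine Tendsto.const_mul _ (Tendsto.const_mul _ ?_)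
  refine tendsto_finsetSum _ fun q _ => ?_
  have h := tendsto_Sfib_pow L (t221Sites T) hLodd hL hm q
  exact h.mul_const _

/-- `Z(T, J_T) > 0`. [cite: King1986, Thm 2.1 (2.23) p.654] -/
theorem kingFreeZlim_pos (J : ∀ T : Torus221 (d + 1), Tor (t221Sites T) → ℝ) (T : Torus221 (d + 1)) : 0 < kingFreeZlim m2 J T :=
  Real.exp_pos _

/-- `ln Z(T, J_T) = ½|Ω_T|⁻¹Σ_q S_∞(p′(q))|J̃_T(q)|²`. [cite: King1986, Thm 2.1 (2.23) p.654] -/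
theorem log_kingFreeZlim_eq (J : ∀ T : Torus221 (d + 1), Tor (t221Sites T) → ℝ) (T : Torus221 (d + 1)) :
    haveI := t221Sites_neZero T
    Real.log (kingFreeZlim m2 J T) = (1 / 2 : ℝ) * ((Fintype.card (Tor (t221Sites T)) : ℝ)⁻¹
      * ∑ q : Tor (t221Sites T), aliasSeries0 m2 (sOf (t221Sites T) q) * ‖ft (t221Sites T) (J T) q‖ ^ 2) := by
  unfold kingFreeZlim
  rw [Real.log_exp]

/-- `0 ≤ ln Z(T, J_T)`. [cite: King1986, Thm 2.1 (2.23) p.654] -/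
theorem log_kingFreeZlim_nonneg (hm : 0 < m2) (J : ∀ T : Torus221 (d + 1), Tor (t221Sites T) → ℝ) (T : Torus221 (d + 1)) :
    0 ≤ Real.log (kingFreeZlim m2 J T) := by
  haveI := t221Sites_neZero T
  rw [log_kingFreeZlim_eq]
  exact mul_nonneg (by norm_num) (fourierSum_aliasSeries0_nonneg (t221Sites T) hm (J T))

omit [NeZero L] in
/-- ★★ **THEOREM 2.1 (ii) (2.23) FOR THE FREE FIELD**: `|ln Z(T, J_T)| ≤ (H²∕(2m²))·|T|` for every torus (2.21) and every source family with `|J_T| ≤ H` — ONE constant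
`C = H²∕(2m²)` («C depends on h»). [cite: King1986, Thm 2.1 (2.23) p.654] -/
theorem abs_log_kingFreeZlim_le (hLodd : Odd L) (hL : 2 ≤ L) (hm : 0 < m2) {J : ∀ T : Torus221 (d + 1), Tor (t221Sites T) → ℝ} {H : ℝ}
    (hJ : ∀ T b, |J T b| ≤ H) (T : Torus221 (d + 1)) :
    |Real.log (kingFreeZlim m2 J T)| ≤ H ^ 2 / (2 * m2) * T.vol := by
  haveI := t221Sites_neZero T
  rw [abs_of_nonneg (log_kingFreeZlim_nonneg m2 hm J T), log_kingFreeZlim_eq, ← card_tor_t221Sites T]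
  have h1 := fourierSum_aliasSeries0_le L (t221Sites T) hLodd hL hm (J T)
  have h2 := dotProduct_self_le_vol (t221Sites T) (hJ T)
  calc (1 / 2 : ℝ) * ((Fintype.card (Tor (t221Sites T)) : ℝ)⁻¹
        * ∑ q : Tor (t221Sites T), aliasSeries0 m2 (sOf (t221Sites T) q) * ‖ft (t221Sites T) (J T) q‖ ^ 2)
      ≤ (1 / 2 : ℝ) * (m2⁻¹ * (J T ⬝ᵥ J T)) := by gcongr
    _ ≤ (1 / 2 : ℝ) * (m2⁻¹ * (H ^ 2 * Fintype.card (Tor (t221Sites T)))) := by gcongr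
    _ = H ^ 2 / (2 * m2) * Fintype.card (Tor (t221Sites T)) := by field_simp

/-- The same bound at every finite `K`: `|ln Z^{ε_K}(T_{ε_K}, J_T∘blk)| ≤ (H²∕(2m²))·|T|`, uniformly in `K`. [cite: King1986, Thm 2.1 (2.23) p.654] -/
theorem abs_log_kingFreeZ_le (hm : 0 < m2) {J : ∀ T : Torus221 (d + 1), Tor (t221Sites T) → ℝ} {H : ℝ}
    (hJ : ∀ T b, |J T b| ≤ H) (T : Torus221 (d + 1)) (K : ℕ) :
    |Real.log (kingFreeZ L m2 J T K)| ≤ H ^ 2 / (2 * m2) * T.vol := by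
  haveI := t221Sites_neZero T
  rw [← card_tor_t221Sites T]
  exact abs_log_kingFineZ_blockSrc_le_vol (L ^ K) (t221Sites T) hm (hJ T)

/-- `0 < Z^{ε_K}(T_{ε_K}, J_T∘blk)`. [folklore] -/
theorem kingFreeZ_pos (hm : 0 < m2) (J : ∀ T : Torus221 (d + 1), Tor (t221Sites T) → ℝ) (T : Torus221 (d + 1)) (K : ℕ) : 0 < kingFreeZ L m2 J T K := by
  haveI := t221Sites_neZero T
  exact kingFineZ_pos (L ^ K) (t221Sites T) hm _

/-- ★★★ **KING's THEOREM 2.1 BY NAME — `Thm21Printed` INHABITED BY THE FREE FIELD**: for odd `L ≥ 2`, `m² > 0` and every family of unit-block sources with `|J_T| ≤ H`,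
the free model's fine-lattice generating functionals `(T, K) ↦ Z^{ε_K}(T_{ε_K}, J_T∘blk)` satisfy the PRINTED Theorem 2.1: (i) `∃ lim_{K→∞} = Z(T, J_T) > 0` on every
torus (2.21), (ii) `|ln Z(T, J_T)| ≤ C|T|` with `C = H²∕(2m²)` for all tori. [cite: King1986, Thm 2.1 (2.22)–(2.23) p.654] -/
theorem thm21Printed_kingFreeZ (hLodd : Odd L) (hL : 2 ≤ L) (hm : 0 < m2) {J : ∀ T : Torus221 (d + 1), Tor (t221Sites T) → ℝ} {H : ℝ}
    (hJ : ∀ T b, |J T b| ≤ H) : Thm21Printed (kingFreeZ L m2 J) :=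
  ⟨H ^ 2 / (2 * m2), fun T =>
    ⟨kingFreeZlim m2 J T, kingFreeZlim_pos m2 J T, tendsto_kingFreeZ L m2 hLodd hL hm J T, abs_log_kingFreeZlim_le L m2 hLodd hL hm hJ T⟩⟩

/-- The source-free case is the trivial twin: `Z^{ε_K}(T_{ε_K}, 0) = 1`. [cite: King1986, Thm 2.1 (2.22) p.654] -/
theorem kingFreeZ_zero (hm : 0 < m2) (T : Torus221 (d + 1)) (K : ℕ) :
    kingFreeZ L m2 (fun _ _ => (0 : ℝ)) T K = 1 := by
  haveI := t221Sites_neZero T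
  rw [kingFreeZ_eq L m2 hm]
  have h0 : (fun b : Tor (t221Sites T) => (0 : ℝ)) = (0 : Tor (t221Sites T) → ℝ) := rfl
  have hft : ∀ q, ft (t221Sites T) (fun _ => (0 : ℝ)) q = 0 := fun q => by simp [ft]
  simp [hft]

end Free

/-! ## §3 The RG-side reading: sources coupled to the block field `ψ_K` (law `ρ_K`), and the (2.15) bridge -/

section Block

variable (L : ℕ) [NeZero L] (a m2 : ℝ)

/-- **The block-field generating functionals**: `Z′(T, K) = ∫ e^{⟨J_T, ψ⟩} ρ_K(ψ)dψ`, `ρ_K = e^{−½⟨ψ,Δ^{(K)}ψ⟩}∕𝒩(Δ^{(K)})` the law of the unit-lattice block field after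
`K` steps of King's renormalization transformation (Theorem 3.1's currency; part Ϡ-k). [cite: King1986, (2.6) p.652, (2.14)–(2.16) p.653, (3.14) p.657] -/
def kingBlockZ (J : ∀ T : Torus221 (d + 1), Tor (t221Sites T) → ℝ) : Torus221 (d + 1) → ℕ → ℝ := fun T K =>
  haveI := t221Sites_neZero T
  ∫ ψ : Tor (t221Sites T) → ℝ, Real.exp (J T ⬝ᵥ ψ)
    * (Real.exp (-(1 / 2 : ℝ) * (ψ ⬝ᵥ (effLaplacian (L ^ K) (t221Sites T) (aK a L K) (((L ^ K : ℕ) : ℝ) ^ 2) m2 *ᵥ ψ)))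
      / gaussNorm (effLaplacian (L ^ K) (t221Sites T) (aK a L K) (((L ^ K : ℕ) : ℝ) ^ 2) m2))

/-- The limit `Z′(T) = exp(½⟨J_T, C^{(∞)}J_T⟩)`. [cite: King1986, Thm 2.1 (2.22) p.654, (2.14) p.653] -/
def kingBlockZlim (J : ∀ T : Torus221 (d + 1), Tor (t221Sites T) → ℝ) (T : Torus221 (d + 1)) : ℝ :=
  haveI := t221Sites_neZero T
  Real.exp ((1 / 2 : ℝ) * (J T ⬝ᵥ ((Matrix.of fun b b' => blockCovLim L (t221Sites T) a m2 b b') *ᵥ J T)))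

/-- `Z′(T, K) = exp(½⟨J_T, (Δ^{(K)})⁻¹J_T⟩)` (`K ≥ 1`). [cite: King1986, (2.6) p.652, (2.14) p.653] -/
theorem kingBlockZ_eq_exp (hL : 2 ≤ L) (ha : 0 < a) (hm : 0 < m2) (J : ∀ T : Torus221 (d + 1), Tor (t221Sites T) → ℝ) (T : Torus221 (d + 1))
    {K : ℕ} (hK : 1 ≤ K) :
    haveI := t221Sites_neZero T
    kingBlockZ L a m2 J T K
      = Real.exp ((1 / 2 : ℝ) * (J T ⬝ᵥ ((effLaplacian (L ^ K) (t221Sites T) (aK a L K) (((L ^ K : ℕ) : ℝ) ^ 2) m2)⁻¹ *ᵥ J T))) := by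
  haveI := t221Sites_neZero T
  have h := mgf_blockField_eq L (t221Sites T) hL ha hm hK (J T)
  unfold kingBlockZ
  exact h

/-- ★★ **THE (2.15) BRIDGE**: the block-field functional IS the fine-lattice functional at the block-constant source, up to the block-spin white noise:
`Z′(T, K) = Z^{ε_K}(T_{ε_K}, J_T∘blk) · e^{|J_T|²∕(2a_K)}` (`K ≥ 1`; part Ϛ's Woodbury form `(Δ^{(K)})⁻¹ = a_K⁻¹·1 + N^dQB⁻¹Qᵀ`).
[cite: King1986, (2.13)–(2.15) p.653, (2.6) p.652] -/
theorem kingBlockZ_eq_kingFreeZ_mul (hL : 2 ≤ L) (ha : 0 < a) (hm : 0 < m2) (J : ∀ T : Torus221 (d + 1), Tor (t221Sites T) → ℝ) (T : Torus221 (d + 1))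
    {K : ℕ} (hK : 1 ≤ K) :
    haveI := t221Sites_neZero T
    kingBlockZ L a m2 J T K = kingFreeZ L m2 J T K * Real.exp ((J T ⬝ᵥ J T) / (2 * aK a L K)) := by
  haveI := t221Sites_neZero T
  have hL1 : (1 : ℝ) < L := by exact_mod_cast (show 1 < L by omega)
  have hLK : 1 ≤ L ^ K := Nat.one_le_pow K L (by omega)
  have haK := aK_pos ha hL1 hK
  rw [kingBlockZ_eq_exp L a m2 hL ha hm J T hK]
  unfold kingFreeZ
  rw [kingFineZ_blockSrc_eq (L ^ K) (t221Sites T) hm, ← Real.exp_add]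
  congr 1
  rw [effLaplacian_inv_eq_noise_add_blockAvg (L ^ K) (t221Sites T) hLK haK hm, Matrix.add_mulVec, dotProduct_add,
    Matrix.smul_mulVec, Matrix.one_mulVec, dotProduct_smul, smul_eq_mul, Matrix.smul_mulVec, dotProduct_smul, smul_eq_mul]
  field_simp
  ring

/-- ★★ `Z′(T, K) → Z′(T) = exp(½⟨J_T, C^{(∞)}J_T⟩)` (part Ϡ-k's MGF convergence read on the torus). [cite: King1986, Thm 2.1 (2.22) p.654] -/
theorem tendsto_kingBlockZ (hLodd : Odd L) (hL : 2 ≤ L) (ha : 0 < a) (hm : 0 < m2) (J : ∀ T : Torus221 (d + 1), Tor (t221Sites T) → ℝ)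
    (T : Torus221 (d + 1)) :
    Tendsto (fun K : ℕ => kingBlockZ L a m2 J T K) atTop (𝓝 (kingBlockZlim L a m2 J T)) := by
  haveI := t221Sites_neZero T
  have h := tendsto_mgf_blockField L (t221Sites T) hLodd hL ha hm (J T)
  rw [mgf_lim_eq L (t221Sites T) hLodd hL ha hm (J T)] at h
  unfold kingBlockZ kingBlockZlim
  exact h

omit [NeZero L] in
/-- `Z′(T) > 0`. [folklore] -/
theorem kingBlockZlim_pos (J : ∀ T : Torus221 (d + 1), Tor (t221Sites T) → ℝ) (T : Torus221 (d + 1)) : 0 < kingBlockZlim L a m2 J T :=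
  Real.exp_pos _

omit [NeZero L] in
/-- `|ln Z′(T)| ≤ ½(a_∞⁻¹ + m⁻²)H²·|T|` for `|J_T| ≤ H` (floor `a_∞⁻¹|J|² ≥ 0`, sharp ceiling §0). [cite: King1986, Thm 2.1 (2.23) p.654, (4.8) p.671] -/
theorem abs_log_kingBlockZlim_le (hLodd : Odd L) (hL : 2 ≤ L) (ha : 0 < a) (hm : 0 < m2) {J : ∀ T : Torus221 (d + 1), Tor (t221Sites T) → ℝ} {H : ℝ}
    (hJ : ∀ T b, |J T b| ≤ H) (T : Torus221 (d + 1)) :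
    |Real.log (kingBlockZlim L a m2 J T)| ≤ ((aInf a L)⁻¹ + m2⁻¹) * H ^ 2 / 2 * T.vol := by
  haveI := t221Sites_neZero T
  have hL1 : (1 : ℝ) < L := by exact_mod_cast (show 1 < L by omega)
  have haInf := aInf_pos ha hL1
  unfold kingBlockZlim
  rw [Real.log_exp, ← card_tor_t221Sites T]
  have hJJ : 0 ≤ J T ⬝ᵥ J T := Literature.LinearAlgebra.Matrix.dotProduct_self_nonneg_real _
  have hlo := blockCovLim_form_ge L (t221Sites T) hLodd hL ha hm (J T)
  have hhi := blockCovLim_form_le_sharp L (t221Sites T) hLodd hL ha hm (J T)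
  have h2 := dotProduct_self_le_vol (t221Sites T) (hJ T)
  have h0 : 0 ≤ J T ⬝ᵥ ((Matrix.of fun b b' => blockCovLim L (t221Sites T) a m2 b b') *ᵥ J T) :=
    le_trans (mul_nonneg (inv_nonneg.mpr haInf.le) hJJ) hlo
  rw [abs_of_nonneg (by positivity)]
  calc (1 / 2 : ℝ) * (J T ⬝ᵥ ((Matrix.of fun b b' => blockCovLim L (t221Sites T) a m2 b b') *ᵥ J T))
      ≤ (1 / 2 : ℝ) * (((aInf a L)⁻¹ + m2⁻¹) * (J T ⬝ᵥ J T)) := by gcongr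
    _ ≤ (1 / 2 : ℝ) * (((aInf a L)⁻¹ + m2⁻¹) * (H ^ 2 * Fintype.card (Tor (t221Sites T)))) := by gcongr
    _ = ((aInf a L)⁻¹ + m2⁻¹) * H ^ 2 / 2 * Fintype.card (Tor (t221Sites T)) := by ring

/-- ★★★ **`Thm21Printed` INHABITED BY THE BLOCK-FIELD FUNCTIONALS**: the RG-side generating functionals `(T, K) ↦ ∫e^{⟨J_T,ψ⟩}ρ_K` of the free field satisfy the
printed Theorem 2.1 with `C = ½(a_∞⁻¹ + m⁻²)H²`. [cite: King1986, Thm 2.1 (2.22)–(2.23) p.654, (2.14)–(2.16) p.653] -/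
theorem thm21Printed_kingBlockZ (hLodd : Odd L) (hL : 2 ≤ L) (ha : 0 < a) (hm : 0 < m2) {J : ∀ T : Torus221 (d + 1), Tor (t221Sites T) → ℝ} {H : ℝ}
    (hJ : ∀ T b, |J T b| ≤ H) : Thm21Printed (kingBlockZ L a m2 J) :=
  ⟨((aInf a L)⁻¹ + m2⁻¹) * H ^ 2 / 2, fun T =>
    ⟨kingBlockZlim L a m2 J T, kingBlockZlim_pos L a m2 J T, tendsto_kingBlockZ L a m2 hLodd hL ha hm J T,
      abs_log_kingBlockZlim_le L a m2 hLodd hL ha hm hJ T⟩⟩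

end Block

end Summit.QuantumFields.YangMills.BalabanUVNodes.N15KingModelRung

end
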